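import Mathlib
import Summits.MatrixMultiplication.Statement
import Summits.MatrixMultiplication.MatrixMultiplication.Theorems.GraphEquationsDepthLadder

/-!
# The depth ladder, sharp form: `CorankBound n c → DepthBound n c` (`GraphEquations`, M63)

Decomp-mm node «GraphEquations» (lens 5, g42); attacked leaf `MultiplicityReduction`
(stmt-MatrixMultiplication-27806).  Target VERBATIM: `_root_.MatrixMultiplication`.  Route-neutral.

M62 placed the corank dial above the depth dial with a shift, `CorankBound n c → DepthBound n (c + 1)`,
through second-order separation and the flat `(W_1,0),…,(W_c,0),(0,𝟙)`.  The shift is unnecessary: along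
the flat of the `c` MIXED directions `(W_a, 𝟙)` — `W_a` spanning the kernel at the base — the line
`(W_a, 𝟙)` alone already carries the second-order row `M_i (W_a 𝟙) = M_i W_a` (M58 `persistsAlong_iff`),
so a persistent kernel vector has all kernel quadrics zero and vanishes
(`Correct.eq_zero_of_persistsAlongFlat_id`; the case `c = 1` is M59's self-direction rigidity).  Hence
**`depthBound_of_corankBound_sharp : CorankBound n c → DepthBound n c`** for EVERY `c` (at `c = 0` both
sides are `AQRₙ`, M62 `depthBound_zero_iff`, M52 `corankBound_zero_iff`), the top of the depth dial drops
to **`depthBound_sq : DepthBound n (n²)`**, i.e. `horizontalUnmask_sq : HorizontalUnmask (n²) n`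
(M60b had `2n²`, M62 `n² + 1`), and purification depth is AT MOST the corank at every base
(`Correct.exists_flat_of_finrank_le_sharp`) — while the pivot designs have corank `≥ n^{3/2}/4` at every
base and depth `1` (M55, M57).
Sources: [BurgisserClausenShokrollahi1997, (15.1), Problem 16.3]; [Strassen1973]; the cell's M52–M62.
-/

-- dupNamespace: forced by the nested Summit.MatrixMultiplication.MatrixMultiplication layout (D-0017)
set_option linter.dupNamespace false

noncomputable section

namespace Summit.MatrixMultiplication.MatrixMultiplication.Theorems.GraphEquations

open Matrix Module

variable {n : ℕ}

namespace AffSystem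

variable {S : AffSystem n}

/-- **Mixed directions `(W_a, 𝟙)` with `W_a` spanning the kernel purify.**  A kernel vector persisting
along the flat `(A,B) + span{(W_a, 𝟙)}` satisfies `δᵀ M_i W_a = 0` for all `i, a` (the second-order row
of the line `(W_a, 𝟙)`), hence vanishes (M62 `Correct.secondOrderSeparates_of_mem_span`). -/
theorem Correct.eq_zero_of_persistsAlongFlat_id (hC : S.Correct) {A B : Vec n} {c : ℕ}
    {W : Fin c → Vec n} (hW : ∀ δ, S.IsKer A B δ → δ ∈ Submodule.span ℂ (Set.range W)) {δ : Vec n}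
    (h : S.PersistsAlongFlat A B W (fun _ => idFun) δ) : δ = 0 := by
  obtain ⟨hK, hline, -⟩ := persistsAlongFlat_iff_pairwise.1 h
  refine hC.secondOrderSeparates_of_mem_span hW δ hK fun i a => ?_
  have := (persistsAlong_iff.1 (hline a)).2.2 i
  rwa [prodVec_idFun] at this

/-- **Depth `≤` corank at every base**: corank `≤ c` at `(A,B)` gives `c` directions there along whose
flat no nonzero kernel vector persists. -/
theorem Correct.exists_flat_of_finrank_le_sharp (hC : S.Correct) {A B : Vec n} {c : ℕ}
    (hc : finrank ℂ (S.kerSpace A B) ≤ c) :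
    ∃ U V : Fin c → Vec n, ∀ δ, S.PersistsAlongFlat A B U V δ → δ = 0 := by
  obtain ⟨W, hW⟩ := exists_spanning_of_finrank_le hc
  exact ⟨W, fun _ => idFun, fun δ hδ => hC.eq_zero_of_persistsAlongFlat_id hW hδ⟩

end AffSystem

/-- **The sharp ladder: `CorankBound n c → DepthBound n c`** for every `c`. -/
theorem depthBound_of_corankBound_sharp {c : ℕ} (h : CorankBound n c) : DepthBound n c := by
  intro S hS
  obtain ⟨A, B, hc⟩ := h S hS
  obtain ⟨U, V, hUV⟩ := hS.exists_flat_of_finrank_le_sharp hc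
  exact ⟨A, B, U, V, hUV⟩

/-- Unconditional top of the depth dial: **`DepthBound n (n²)`**. -/
theorem depthBound_sq (n : ℕ) : DepthBound n (n * n) := depthBound_of_corankBound_sharp corankBound_sq

/-- … in the equation-system language: **`HorizontalUnmask (n²) n`**. -/
theorem horizontalUnmask_sq (n : ℕ) : HorizontalUnmask (n * n) n :=
  horizontalUnmask_of_depthBound (depthBound_sq n)

/-- `CorankBound n c → HorizontalUnmask c n`: every corank dial implies the horizontal dial of the same
order (and the linear corank dial is refuted, M55, while `HorizontalUnmask 1 n` is open). -/
theorem horizontalUnmask_of_corankBound {c : ℕ} (h : CorankBound n c) : HorizontalUnmask c n :=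
  horizontalUnmask_of_depthBound (depthBound_of_corankBound_sharp h)

end Summit.MatrixMultiplication.MatrixMultiplication.Theorems.GraphEquations

end
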